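import Mathlib
import HarnessLib

/-!
# Bracket modulus — `stub_bracketModulus` (stub BM) of line `swap-odd-threshold-rigidity`
(crux `EmbeddedDrudeMourre.MourreDissolution`, item stmt-AtomisticToContinuum-12594; helper file, `--supports`)

Registered stub BM of the checked skeleton of line `swap-odd-threshold-rigidity` (lead c8), in the
skeleton's stub namespace `Summit.AtomisticToContinuum.FouriersLaw.Theorems.MourreDissolution`.

The collision bracket `[f] = f(k₁) + f(k₂) − f(k₃) − f(k₄)`, `k₄ = k₁ + k₂ − k₃`, of a `2π`-periodic
`C²` profile `f` vanishes linearly on both exchange planes `k₃ ≡ k₁`, `k₂ ≡ k₃ (mod 2π)`: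
there is `K ≥ 0` with `|[f]| ≤ K·|sin((k₃−k₁)/2) sin((k₂−k₃)/2)|` for all real `k₁ k₂ k₃`
(one may take `K = π²·sup|f″|`).

Proof (pure real analysis, no cited facts).
* `f″ = deriv (deriv f)` is continuous (`C²`) and `2π`-periodic, hence bounded by some `B` (its range is
  the continuous image of the compact period cell `[0, 2π]`).
* Mean value theorem twice: `f′` is `B`-Lipschitz, so `G(x) = f(x) − f(x − p)` with `p = k₃ − k₁` has
  `|G′| ≤ B|p|`, whence `|[f]| = |G(k₂) − G(k₃)| ≤ B·|k₃ − k₁|·|k₂ − k₃|` for all reals.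
* Both sides being invariant under `k₁ ↦ k₁ + 2πn`, `k₂ ↦ k₂ − 2πm` (periodicity of `f`,
  antiperiodicity of `sin`), reduce to `|k₃ − k₁|, |k₂ − k₃| ≤ π` (`round`), where Jordan's inequality
  `|x| ≤ π|sin(x/2)|` (`Real.mul_le_sin`) gives the claim with `K = π²·B`.
-/

noncomputable section

namespace Summit.AtomisticToContinuum.FouriersLaw.Theorems.MourreDissolution

open Real

/-! ### Elementary inputs -/

/-- Jordan's inequality in half-angle form: `|x| ≤ π·|sin(x/2)|` for `|x| ≤ π`. [folklore] -/
theorem bracketModulus_abs_le_pi_mul_abs_sin_half {x : ℝ} (hx : |x| ≤ π) :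
    |x| ≤ π * |Real.sin (x / 2)| := by
  have h1 : 2 / π * (|x| / 2) ≤ Real.sin (|x| / 2) :=
    Real.mul_le_sin (by positivity) (by linarith)
  have h2 : Real.sin (|x| / 2) ≤ |Real.sin (x / 2)| := by
    rcases abs_choice x with h | h
    · rw [h]; exact le_abs_self _
    · rw [h, neg_div, Real.sin_neg]; exact neg_le_abs _
  calc |x| = π * (2 / π * (|x| / 2)) := by field_simp
    _ ≤ π * |Real.sin (x / 2)| := mul_le_mul_of_nonneg_left (h1.trans h2) Real.pi_pos.le

/-- Reduction modulo `2π` into `[-π, π]`: `|x − 2πn| ≤ π` for `n = round (x / 2π)`. [folklore] -/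
theorem bracketModulus_exists_reduce (x : ℝ) : ∃ n : ℤ, |x - n * (2 * π)| ≤ π := by
  refine ⟨round (x / (2 * π)), ?_⟩
  have h := abs_sub_round (x / (2 * π))
  have e : x - (round (x / (2 * π)) : ℝ) * (2 * π)
      = 2 * π * (x / (2 * π) - round (x / (2 * π))) := by
    rw [mul_sub, mul_div_cancel₀ x (ne_of_gt Real.two_pi_pos)]
    ring
  rw [e, abs_mul, abs_of_pos Real.two_pi_pos]
  calc 2 * π * |x / (2 * π) - round (x / (2 * π))| ≤ 2 * π * (1 / 2) :=
        mul_le_mul_of_nonneg_left h Real.two_pi_pos.le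
    _ = π := by ring

/-- `|sin|` only depends on the angle modulo `2π` (indeed modulo `π`):
`|sin((x − 2πn)/2)| = |sin(x/2)|`. [folklore] -/
theorem bracketModulus_abs_sin_half_reduce (x : ℝ) (n : ℤ) :
    |Real.sin ((x - n * (2 * π)) / 2)| = |Real.sin (x / 2)| := by
  rw [show (x - n * (2 * π)) / 2 = x / 2 - n * π by ring, Real.sin_sub_int_mul_pi, abs_mul,
    abs_neg_one_zpow, one_mul]

/-! ### Calculus inputs -/

/-- The derivative of a `c`-periodic function is `c`-periodic. [folklore] -/
theorem bracketModulus_periodic_deriv {g : ℝ → ℝ} {c : ℝ} (h : Function.Periodic g c) :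
    Function.Periodic (deriv g) c := by
  intro x
  have hfun : (fun y => g (y + c)) = g := funext h
  rw [← deriv_comp_add_const g c x, hfun]

/-- Unpacking `C²` on the line: `f` and `f′ = deriv f` are differentiable and `f″ = deriv (deriv f)`
is continuous. [folklore] -/
theorem bracketModulus_contDiff_two {f : ℝ → ℝ} (hf : ContDiff ℝ 2 f) :
    Differentiable ℝ f ∧ Differentiable ℝ (deriv f) ∧ Continuous (deriv (deriv f)) := by
  rw [← one_add_one_eq_two] at hf
  have h := contDiff_succ_iff_deriv.mp hf
  exact ⟨h.1, h.2.2.differentiable one_ne_zero, h.2.2.continuous_deriv le_rfl⟩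

/-- A `2π`-periodic `C²` function has a bounded second derivative. [folklore] -/
theorem bracketModulus_exists_bound_deriv2 {f : ℝ → ℝ} (hper : Function.Periodic f (2 * π))
    (hf : ContDiff ℝ 2 f) : ∃ B : ℝ, ∀ x, |deriv (deriv f) x| ≤ B := by
  have hcont : Continuous (deriv (deriv f)) := (bracketModulus_contDiff_two hf).2.2
  have hper2 : Function.Periodic (deriv (deriv f)) (2 * π) :=
    bracketModulus_periodic_deriv (bracketModulus_periodic_deriv hper)
  obtain ⟨B, hB⟩ := (isCompact_Icc : IsCompact (Set.Icc (0 : ℝ) (0 + 2 * π))).exists_bound_of_continuousOn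
    hcont.continuousOn
  refine ⟨B, fun x => ?_⟩
  have hx : deriv (deriv f) x ∈ Set.range (deriv (deriv f)) := Set.mem_range_self x
  rw [← hper2.image_Icc Real.two_pi_pos 0] at hx
  obtain ⟨y, hy, hyx⟩ := hx
  rw [← hyx, ← Real.norm_eq_abs]
  exact hB y hy

/-- Mean value theorem for `f′`: if `|f″| ≤ B` then `f′` is `B`-Lipschitz. [folklore] -/
theorem bracketModulus_deriv_lipschitz {f : ℝ → ℝ} (hf : ContDiff ℝ 2 f) {B : ℝ}
    (hB : ∀ x, |deriv (deriv f) x| ≤ B) (x y : ℝ) :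
    |deriv f y - deriv f x| ≤ B * |y - x| := by
  have hd : Differentiable ℝ (deriv f) := (bracketModulus_contDiff_two hf).2.1
  have h := convex_univ.norm_image_sub_le_of_norm_deriv_le (f := deriv f)
    (fun z _ => hd z) (fun z _ => (Real.norm_eq_abs _).trans_le (hB z)) (Set.mem_univ x)
    (Set.mem_univ y)
  rwa [Real.norm_eq_abs, Real.norm_eq_abs] at h

/-- The raw (non-periodic) bracket bound: `|[f]| ≤ B·|k₃ − k₁|·|k₂ − k₃|` whenever `|f″| ≤ B`
(mean value theorem applied to `G(x) = f(x) − f(x − (k₃ − k₁))`, whose derivative is bounded by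
`B|k₃ − k₁|` by the Lipschitz bound on `f′`; `[f] = G(k₂) − G(k₃)`). [folklore] -/
theorem bracketModulus_raw {f : ℝ → ℝ} (hf : ContDiff ℝ 2 f) {B : ℝ}
    (hB : ∀ x, |deriv (deriv f) x| ≤ B) (k₁ k₂ k₃ : ℝ) :
    |f k₁ + f k₂ - f k₃ - f (k₁ + k₂ - k₃)| ≤ B * |k₃ - k₁| * |k₂ - k₃| := by
  have hD : Differentiable ℝ f := (bracketModulus_contDiff_two hf).1
  have hG : ∀ x, HasDerivAt (fun y => f y - f (y - (k₃ - k₁)))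
      (deriv f x - deriv f (x - (k₃ - k₁))) x := fun x =>
    (hD x).hasDerivAt.sub (HasDerivAt.comp_sub_const x (k₃ - k₁) (hD (x - (k₃ - k₁))).hasDerivAt)
  have hGb : ∀ x, ‖deriv f x - deriv f (x - (k₃ - k₁))‖ ≤ B * |k₃ - k₁| := fun x => by
    have h := bracketModulus_deriv_lipschitz hf hB (x - (k₃ - k₁)) x
    rw [show x - (x - (k₃ - k₁)) = k₃ - k₁ by ring] at h
    rwa [Real.norm_eq_abs]
  have key := convex_univ.norm_image_sub_le_of_norm_hasDerivWithin_le
    (fun x _ => (hG x).hasDerivWithinAt) (fun x _ => hGb x) (Set.mem_univ k₃) (Set.mem_univ k₂)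
  rw [Real.norm_eq_abs, Real.norm_eq_abs, show k₂ - (k₃ - k₁) = k₁ + k₂ - k₃ by ring,
    show k₃ - (k₃ - k₁) = k₁ by ring] at key
  rw [show f k₁ + f k₂ - f k₃ - f (k₁ + k₂ - k₃) = f k₂ - f (k₁ + k₂ - k₃) - (f k₃ - f k₁) by ring]
  exact key

/-! ### The stub -/

/-- **Bracket modulus** (stub BM of line `swap-odd-threshold-rigidity`). For a `2π`-periodic `C²`
profile `f` the collision bracket `[f] = f k₁ + f k₂ − f k₃ − f (k₁ + k₂ − k₃)` satisfies
`|[f]| ≤ K·|sin((k₃ − k₁)/2)·sin((k₂ − k₃)/2)|` for some `K ≥ 0` (here `K = π²·sup|f″|`): it vanishes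
linearly on both exchange planes. [folklore] -/
theorem stub_bracketModulus :
    ∀ f : ℝ → ℝ, Function.Periodic f (2 * Real.pi) → ContDiff ℝ 2 f → ∃ K : ℝ, 0 ≤ K ∧
      ∀ k₁ k₂ k₃ : ℝ, |f k₁ + f k₂ - f k₃ - f (k₁ + k₂ - k₃)| ≤
        K * |Real.sin ((k₃ - k₁) / 2) * Real.sin ((k₂ - k₃) / 2)| := by
  intro f hper hf
  obtain ⟨B, hB⟩ := bracketModulus_exists_bound_deriv2 hper hf
  have hB0 : 0 ≤ B := (abs_nonneg _).trans (hB 0)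
  refine ⟨π ^ 2 * B, mul_nonneg (sq_nonneg _) hB0, fun k₁ k₂ k₃ => ?_⟩
  obtain ⟨n, hn⟩ := bracketModulus_exists_reduce (k₃ - k₁)
  obtain ⟨m, hm⟩ := bracketModulus_exists_reduce (k₂ - k₃)
  -- the raw bound at the shifted momenta `k₁ + 2πn`, `k₂ − 2πm`, `k₃`
  have raw := bracketModulus_raw hf hB (k₁ + n * (2 * π)) (k₂ - m * (2 * π)) k₃
  have e₃ : f (k₁ + n * (2 * π) + (k₂ - m * (2 * π)) - k₃) = f (k₁ + k₂ - k₃) := by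
    rw [show k₁ + n * (2 * π) + (k₂ - m * (2 * π)) - k₃
        = k₁ + k₂ - k₃ + n * (2 * π) - m * (2 * π) by ring, hper.sub_int_mul_eq m,
      hper.int_mul n (k₁ + k₂ - k₃)]
  rw [hper.int_mul n k₁, hper.sub_int_mul_eq m, e₃,
    show k₃ - (k₁ + n * (2 * π)) = k₃ - k₁ - n * (2 * π) by ring,
    show k₂ - m * (2 * π) - k₃ = k₂ - k₃ - m * (2 * π) by ring] at raw
  have j₁ := bracketModulus_abs_le_pi_mul_abs_sin_half hn
  have j₂ := bracketModulus_abs_le_pi_mul_abs_sin_half hm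
  rw [abs_mul, ← bracketModulus_abs_sin_half_reduce (k₃ - k₁) n,
    ← bracketModulus_abs_sin_half_reduce (k₂ - k₃) m]
  calc |f k₁ + f k₂ - f k₃ - f (k₁ + k₂ - k₃)|
      ≤ B * |k₃ - k₁ - n * (2 * π)| * |k₂ - k₃ - m * (2 * π)| := raw
    _ = B * (|k₃ - k₁ - n * (2 * π)| * |k₂ - k₃ - m * (2 * π)|) := by ring
    _ ≤ B * (π * |Real.sin ((k₃ - k₁ - n * (2 * π)) / 2)| *
          (π * |Real.sin ((k₂ - k₃ - m * (2 * π)) / 2)|)) :=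
        mul_le_mul_of_nonneg_left (mul_le_mul j₁ j₂ (abs_nonneg _) (by positivity)) hB0
    _ = π ^ 2 * B * (|Real.sin ((k₃ - k₁ - n * (2 * π)) / 2)| *
          |Real.sin ((k₂ - k₃ - m * (2 * π)) / 2)|) := by ring

end Summit.AtomisticToContinuum.FouriersLaw.Theorems.MourreDissolution
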